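import Literature.NumberTheory.LFunctions.ZetaLowHeightZeros
import HarnessLib

/-!
# Kernel-checked certificate: `ζ ≠ 0` on `(0, ½) × (4, 15/2]`

Trunk T-ANT (NumberTheory/LFunctions). One of the seven certificate files of the certified
low-height computation behind `Literature.NumberTheory.LFunctions.speiser_iff` (Levinson–Montgomery's Theorem 1 (1.2) needs
`ζ ≠ 0` on `(0,½) × (0, 10.5]` and `ζ' ≠ 0` on `(0,½) × (0, 10]`; classically Gram 1903 and
Spira 1965). The literal `Literature.NumberTheory.LFunctions.ZetaLowHeightZeros.ZetaNum.certZeta4to7h` lists, for the four edges of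
`[0, ½] × [4, 15/2]`, pieces with quadrant labels (scaled integers at `2^48`); it was produced by
an external planner that mirrors the checker bit for bit, but its validity rests only on the
kernel evaluation `Literature.RH.ZetaNum.certZeta4to7h_ok : certCheck 0 certZeta4to7h = true`
(`decide +kernel`, Euler–Maclaurin `N = 6` enclosures in fixed-point interval arithmetic and the
winding-number certificate theorem; see `ZetaLowHeightZeros.lean`). No axioms beyond
`propext`, `Classical.choice`, `Quot.sound`.

## Main results

* `Literature.NumberTheory.LFunctions.ZetaLowHeightZeros.ZetaNum.certZeta4to7h_ok` — the kernel check.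
* `Literature.NumberTheory.LFunctions.ZetaLowHeightZeros.ZetaNum.riemannZeta_ne_zero_Zeta4to7h` — `ζ(s) ≠ 0` for `0 < Re s < ½`, `4 < Im s ≤ 15/2`.
-/

namespace Literature.NumberTheory.LFunctions.ZetaLowHeightZeros.ZetaNum

/-- The certificate data for `ζ` on `[0, ½] × [4, 15/2]` (bottom, right, top, left edges).
[folklore] -/
def certZeta4to7h : ZetaNum.Cert :=
  ⟨1125899906842624, 2111062325329920, 118366077452288, 0, [(140737488355328, 0)],
  1219534488862720, 0, [(1317831257882624, 0), (1421551496855552, 0), (1529639717568512, 0), (1643297437122560, 0), (1763090517458944, 0), (1887944143011840, 0), (2018778510524416, 0), (2111062325329920, 0)],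
  140737488355328, 0, [],
  1187128960614400, 0, [(1250465769586688, 0), (1316271111012352, 0), (1384506330185728, 0), (1454264115265536, 0), (1526272463208448, 0), (1601279772065792, 0), (1679798216687616, 0), (1761545402974208, 0), (1846010229817344, 0), (1933714535743488, 0), (2025068490129408, 0), (2111062325329920, 0)]⟩

/-- **The kernel check of the certificate.** [folklore] -/
theorem certZeta4to7h_ok : ZetaNum.certCheck 0 certZeta4to7h = true := by
  decide +kernel

/-- **`ζ(s) ≠ 0` for `0 < Re s < ½`, `4 < Im s ≤ 15/2`** (certified computation).
[folklore] -/
theorem riemannZeta_ne_zero_Zeta4to7h {s : ℂ} (h0 : 0 < s.re) (h1 : s.re < 1 / 2)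
    (h2 : (4 : ℝ) < s.im) (h3 : s.im ≤ 15 / 2) : riemannZeta s ≠ 0 :=
  ZetaNum.riemannZeta_ne_zero_of_certCheck certZeta4to7h_ok h0 h1
    (by norm_num [certZeta4to7h, Literature.Analysis.ValidatedNumerics.Numerics.SC]; exact h2)
    (by norm_num [certZeta4to7h, Literature.Analysis.ValidatedNumerics.Numerics.SC]; exact h3)

end Literature.NumberTheory.LFunctions.ZetaLowHeightZeros.ZetaNum
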